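import Summits.HubbardSuperconductivity.HubbardSuperconductivity.Theorems.MesoscopicPairOrder.Negative.StonerShiftedBand
import Mathlib.Analysis.Real.Pi.Bounds
import HarnessLib

/-!
# Crux `MesoscopicPairOrder` (stmt-HubbardSuperconductivity-7331), Negative side:
# NO NEARLY SATURATED FERROMAGNETISM FOR `U ≤ 6/5` ON `δ ∈ [1/10, 3/10]`

Line `redirect_birth` (lead c10); companion of `StonerShiftedBand.lean` (the parametric Stoner ceiling
`(μ + 4)(n - S) ≥ 2μ n - L²(4+t²)/(4(t-μ)) - 2Σ_l ε - U n`). Here the lattice sums are evaluated: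

* `spinDeficiency_ge_of_moderateCoupling` — **for `0 ≤ U ≤ 6/5`, `δ ∈ [1/10, 3/10]` and every `L ≥ 4000`, every
  ground state `ψ` of the `(2n, S^z = 0)` sector (`n = ⌊(1-δ)L²/2⌋`) of `hubbardTorus 2 L 1 U` with `S² ψ = S(S+1) ψ`,
  `S ≤ n`, has `n - S ≥ L²/200`.** Two pieces, both with the centred-square paired Fermi sea of
  `exists_trialSet_card_eq` (largest odd square `m × m`, `m² ≤ n < (m+2)²`): for `δ ≤ 1/5` the band-edge bound
  `eight_spin_le_of_pairedSea` with `m > 0.6324 L - 3`, `sin(mπ/L) ≥ 0.855`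
  (`8(n - S) ≥ 8n - 4L² + (32/π)·0.855·(0.6324L - 3)L - 8(4L+3) - (6/5) n ≥ 0.08 L²`); for `δ ≥ 1/5` the shifted
  bound `shifted_spin_le_of_pairedSea` at `μ = 9/10`, `t = 31/10` (moment term `1361/880 · L²`) with
  `m > 0.5916 L - 3`, `sin(mπ/L) ≥ 0.913` (`4.9 (n - S) ≥ 0.6 n - 1.5466 L² + (32/π)·0.913·(0.5916L - 3)L - 8(4L+3) ≥ 0.029 L²`).
* `not_nearlySaturated_frequently_of_moderateCoupling` — hence the near-saturation hypothesis of the refuter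
  instruments `pointwise_false_of_nearlySaturated` (crux body) and `fluctuationFloorAt_false_of_nearlySaturated`
  (stub (Q)) fails at every `(U, δ) ∈ [0, 6/5] × [1/10, 3/10]`; supersedes the `U ≤ 1/2` statement
  `not_nearlySaturated_frequently_of_weakCoupling` (p153833).

Reach of the method (continuum values per site, `ν = (1-δ)/2`, for the planners): the exact Stoner gap
`K₁(1-δ) - 2K₁(ν) = 1.27 / 1.01 / 0.81` at `δ = 0.1 / 0.2 / 0.3` would, with the EXACT paired-sea doublon density
`ν²` (not in the tree; here only `⟨D⟩ ≤ n`), exclude near-saturation up to `U ≈ 6.3` on the whole `δ`-range, i.e. on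
the full (Q)/(D) box `(0,6] × [1/10,3/10]`; with `⟨D⟩ ≤ n` up to `U ≈ 2.3–2.8`; the square sea and the degree-2 moment
bound give `U < 2.37 / 1.67 / 1.50` in the limit and `6/5` uniformly with the `L ≥ 4000` error terms used here.

Sources: E. C. Stoner, Proc. R. Soc. A 165 (1938) 372; H. Tasaki, Prog. Theor. Phys. 99 (1998) 489, §5;
E. H. Lieb, PRL 62 (1989) 1201. Folklore finite-dimensional statements; no definition, no named fact, no sorry.
-/

noncomputable section

-- the summit namespace repeats the problem name by design (D-0017)
set_option linter.dupNamespace false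

namespace Summit.HubbardSuperconductivity.HubbardSuperconductivity.Theorems.MesoscopicPairOrder.Negative

open Matrix Finset Filter
open Literature.Probability.LatticeModels Literature.MathematicalPhysics.QuantumLattice
open scoped ComplexOrder ComplexConjugate

/-! ### No near-saturation for `U ≤ 6/5` on `δ ∈ [1/10, 3/10]` -/

section Moderate

variable {L : ℕ} [NeZero L]

omit [NeZero L] in
/-- **`sin(π s) ≥ 0.913` for `1/2 ≤ s ≤ 0.6325`** (`sin(πs) = cos(π(s - 1/2)) ≥ 1 - (0.1325π)²/2`). The side
ratios `m/L` of the trial squares for `δ ≥ 1/5` lie in this range. [folklore] -/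
theorem sin_pi_mul_ge' {s : ℝ} (hs1 : 1 / 2 ≤ s) (hs2 : s ≤ 0.6325) : 0.913 ≤ Real.sin (Real.pi * s) := by
  have hπ := Real.pi_pos
  have hπ3 := Real.pi_lt_d6
  rw [← Real.cos_sub_pi_div_two]
  have hx0 : 0 ≤ Real.pi * s - Real.pi / 2 := by nlinarith
  have hxy : Real.pi * s - Real.pi / 2 ≤ Real.pi * 0.1325 := by nlinarith
  have hyπ : Real.pi * 0.1325 ≤ Real.pi := by nlinarith
  have h1 : Real.cos (Real.pi * 0.1325) ≤ Real.cos (Real.pi * s - Real.pi / 2) :=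
    Real.cos_le_cos_of_nonneg_of_le_pi hx0 hyπ hxy
  have h2 : 1 - (Real.pi * 0.1325) ^ 2 / 2 ≤ Real.cos (Real.pi * 0.1325) := Real.one_sub_sq_div_two_le_cos
  have h3 : (Real.pi * 0.1325) ^ 2 ≤ (3.141593 * 0.1325) ^ 2 :=
    pow_le_pow_left₀ (by positivity) (by nlinarith) 2
  nlinarith

omit [NeZero L] in
/-- Side ratio of the largest centred odd square, low-doping piece (pure arithmetic): `m² ≤ n < (m+2)²`,
`0.4 L² - 1 ≤ n ≤ 0.45 L²`, `L ≥ 4000` give `0.6324 L - 3 < m < 0.6709 L`. [folklore] -/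
theorem square_side_bounds_low {L m n : ℝ} (hL : 4000 ≤ L) (hm0 : 0 ≤ m) (h1 : m ^ 2 ≤ n)
    (h2 : n < (m + 2) ^ 2) (hn1 : n ≤ 0.45 * L ^ 2) (hn2 : 0.4 * L ^ 2 - 1 ≤ n) :
    0.6324 * L - 3 < m ∧ m < 0.6709 * L := by
  have hLpos : 0 < L := by linarith
  constructor
  · have hsq : (0.6324 * L - 1) ^ 2 ≤ 0.4 * L ^ 2 - 1 := by nlinarith
    have hlt : (0.6324 * L - 1) ^ 2 < (m + 2) ^ 2 := by linarith
    have := lt_of_pow_lt_pow_left₀ 2 (by positivity) hlt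
    linarith
  · have hlt : m ^ 2 < (0.6709 * L) ^ 2 := by nlinarith
    exact lt_of_pow_lt_pow_left₀ 2 (by positivity) hlt

omit [NeZero L] in
/-- Side ratio of the largest centred odd square, high-doping piece (pure arithmetic): `m² ≤ n < (m+2)²`,
`0.35 L² - 1 ≤ n ≤ 0.4 L²`, `L ≥ 4000` give `0.5916 L - 3 < m < 0.6325 L`. [folklore] -/
theorem square_side_bounds_high {L m n : ℝ} (hL : 4000 ≤ L) (hm0 : 0 ≤ m) (h1 : m ^ 2 ≤ n)
    (h2 : n < (m + 2) ^ 2) (hn1 : n ≤ 0.4 * L ^ 2) (hn2 : 0.35 * L ^ 2 - 1 ≤ n) :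
    0.5916 * L - 3 < m ∧ m < 0.6325 * L := by
  have hLpos : 0 < L := by linarith
  constructor
  · have hsq : (0.5916 * L - 1) ^ 2 ≤ 0.35 * L ^ 2 - 1 := by nlinarith
    have hlt : (0.5916 * L - 1) ^ 2 < (m + 2) ^ 2 := by linarith
    have := lt_of_pow_lt_pow_left₀ 2 (by positivity) hlt
    linarith
  · have hlt : m ^ 2 < (0.6325 * L) ^ 2 := by nlinarith
    exact lt_of_pow_lt_pow_left₀ 2 (by positivity) hlt

omit [NeZero L] in
/-- Bookkeeping of the low-doping piece (band-edge bound; pure arithmetic): `8S ≤ 4L² + 2T + U n`,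
`T ≤ -4AB + 4·sur`, `AB ≥ 0.855 (0.6324 L - 3) L/3.141593`, `sur ≤ 4L + 3`, `U ≤ 6/5`, `0.4 L² - 1 ≤ n`,
`L ≥ 4000` give `L²/200 ≤ n - S`. [folklore] -/
theorem deficiency_arith_low {L n S T A B sur U : ℝ} (hL : 4000 ≤ L) (hU1 : U ≤ 6 / 5)
    (hn : 0.4 * L ^ 2 - 1 ≤ n) (hstoner : 8 * S ≤ 4 * L ^ 2 + 2 * T + U * n)
    (hT : T ≤ -4 * A * B + 4 * sur) (hM : 0.855 * (0.6324 * L - 3) * (L * (1 / 3.141593)) ≤ A * B)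
    (hsur : sur ≤ 4 * L + 3) : L ^ 2 / 200 ≤ n - S := by
  have hLpos : 0 < L := by linarith
  have hLL : 4000 * L ≤ L ^ 2 := by nlinarith
  have hT' : T ≤ -4 * (A * B) + 4 * sur := by linarith
  have hUn : U * n ≤ 6 / 5 * n := by nlinarith
  nlinarith [hstoner, hT', hM, hsur, hUn, hLL]

omit [NeZero L] in
/-- Bookkeeping of the high-doping piece (shifted bound at `μ = 9/10`, `t = 31/10`; pure arithmetic):
`2μ n - L²(4+t²)/(4(t-μ)) - 2T - U n ≤ (μ+4)(n - S)`, `T ≤ -4AB + 4·sur`,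
`AB ≥ 0.913 (0.5916 L - 3) L/3.141593`, `sur ≤ 4L + 3`, `U ≤ 6/5`, `0.35 L² - 1 ≤ n`, `L ≥ 4000` give
`L²/200 ≤ n - S`. [folklore] -/
theorem deficiency_arith_high {L n S T A B sur U : ℝ} (hL : 4000 ≤ L) (hU1 : U ≤ 6 / 5)
    (hn : 0.35 * L ^ 2 - 1 ≤ n)
    (hstoner : 2 * (9 / 10 : ℝ) * n - L ^ 2 * (4 + (31 / 10 : ℝ) ^ 2) / (4 * (31 / 10 - 9 / 10)) - 2 * T -
      U * n ≤ (9 / 10 + 4) * (n - S))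
    (hT : T ≤ -4 * A * B + 4 * sur) (hM : 0.913 * (0.5916 * L - 3) * (L * (1 / 3.141593)) ≤ A * B)
    (hsur : sur ≤ 4 * L + 3) : L ^ 2 / 200 ≤ n - S := by
  have hLpos : 0 < L := by linarith
  have hLL : 4000 * L ≤ L ^ 2 := by nlinarith
  have hT' : T ≤ -4 * (A * B) + 4 * sur := by linarith
  have hUn : U * n ≤ 6 / 5 * n := by nlinarith
  norm_num at hstoner
  nlinarith [hstoner, hT', hM, hsur, hUn, hLL]

omit [NeZero L] in
/-- The filling `n = ⌊(1-δ)L²/2⌋` in real terms on `δ ∈ [1/10, 3/10]`, `L ≥ 4000` (pure arithmetic):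
`1 ≤ n ≤ L²`, `0.35 L² - 1 ≤ n ≤ 0.45 L²`, and the piece bounds `0.4 L² - 1 ≤ n` (`δ ≤ 1/5`),
`n ≤ 0.4 L²` (`δ ≥ 1/5`). [folklore] -/
theorem filling_bounds {δ L n : ℝ} (hL : 4000 ≤ L) (hδ1 : 1 / 10 ≤ δ) (hδ2 : δ ≤ 3 / 10)
    (hn_le : n ≤ (1 - δ) * L ^ 2 / 2) (hn_ge : (1 - δ) * L ^ 2 / 2 - 1 ≤ n) :
    1 ≤ n ∧ n ≤ L ^ 2 ∧ n ≤ 0.45 * L ^ 2 ∧ 0.35 * L ^ 2 - 1 ≤ n ∧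
      (δ ≤ 1 / 5 → 0.4 * L ^ 2 - 1 ≤ n) ∧ (1 / 5 ≤ δ → n ≤ 0.4 * L ^ 2) := by
  have hL2 : (4000 : ℝ) * 4000 ≤ L ^ 2 := by nlinarith
  have hδL1 : 1 / 10 * L ^ 2 ≤ δ * L ^ 2 := mul_le_mul_of_nonneg_right hδ1 (sq_nonneg L)
  have hδL2 : δ * L ^ 2 ≤ 3 / 10 * L ^ 2 := mul_le_mul_of_nonneg_right hδ2 (sq_nonneg L)
  refine ⟨by nlinarith, by nlinarith, by nlinarith, by nlinarith, fun h5 => ?_, fun h5 => ?_⟩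
  · have : δ * L ^ 2 ≤ 1 / 5 * L ^ 2 := mul_le_mul_of_nonneg_right h5 (sq_nonneg L)
    nlinarith
  · have : 1 / 5 * L ^ 2 ≤ δ * L ^ 2 := mul_le_mul_of_nonneg_right h5 (sq_nonneg L)
    nlinarith

/-- **EXTENSIVE SPIN DEFICIENCY FOR `U ≤ 6/5`.** For `0 ≤ U ≤ 6/5`, `δ ∈ [1/10, 3/10]`, every `L ≥ 4000` and
every ground state `ψ` of the `(2n, S^z = 0)` sector (`n = ⌊(1-δ)L²/2⌋`) of `hubbardTorus 2 L 1 U` with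
`S² ψ = S(S+1) ψ`, `S ≤ n`: `L²/200 ≤ n - S`. Two pieces: `δ ≤ 1/5` by the band-edge Stoner bound
`eight_spin_le_of_pairedSea`, `δ ≥ 1/5` by the shifted bound `shifted_spin_le_of_pairedSea` at `μ = 9/10`,
`t = 31/10`; both with the centred-square paired sea `exists_trialSet_card_eq`. Stoner (1938); Tasaki (1998) §5.
[folklore] -/
theorem spinDeficiency_ge_of_moderateCoupling {U δ : ℝ} (hU : U ∈ Set.Icc (0:ℝ) (6 / 5))
    (hδ : δ ∈ Set.Icc (1 / 10 : ℝ) (3 / 10)) {L : ℕ} [NeZero L] (hL : 4000 ≤ L)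
    {ψ : Fock (Orb (FermionTorus 2 L))}
    (hgs : IsGroundStateInSector (hubbardTorus 2 L 1 U) (2 * ⌊(1 - δ) * (L : ℝ) ^ 2 / 2⌋₊) 0 ψ)
    {S : ℕ} (hS : S ≤ ⌊(1 - δ) * (L : ℝ) ^ 2 / 2⌋₊)
    (hspin : spinSq *ᵥ ψ = (((S : ℝ) * ((S : ℝ) + 1) : ℝ) : ℂ) • ψ) :
    (L : ℝ) ^ 2 / 200 ≤ ((⌊(1 - δ) * (L : ℝ) ^ 2 / 2⌋₊ - S : ℕ) : ℝ) := by
  obtain ⟨hU0, hU1⟩ := hU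
  obtain ⟨hδ1, hδ2⟩ := hδ
  set n : ℕ := ⌊(1 - δ) * (L : ℝ) ^ 2 / 2⌋₊ with hn_def
  have hL3 : 3 ≤ L := le_trans (by norm_num) hL
  have hLr : (4000 : ℝ) ≤ L := by exact_mod_cast hL
  have hLpos : (0 : ℝ) < L := by linarith
  -- the filling `n` in real terms
  have hx0 : 0 ≤ (1 - δ) * (L : ℝ) ^ 2 / 2 := by
    have : 0 ≤ 1 - δ := by linarith
    positivity
  have hn_le : (n : ℝ) ≤ (1 - δ) * (L : ℝ) ^ 2 / 2 := Nat.floor_le hx0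
  have hn_ge : (1 - δ) * (L : ℝ) ^ 2 / 2 - 1 ≤ (n : ℝ) := by
    have := Nat.lt_floor_add_one ((1 - δ) * (L : ℝ) ^ 2 / 2)
    linarith
  obtain ⟨hn1r, hnLr, hn45, hn35, hlow_of, hhigh_of⟩ := filling_bounds hLr hδ1 hδ2 hn_le hn_ge
  have hn1 : 1 ≤ n := by exact_mod_cast hn1r
  have hnL : n ≤ L ^ 2 := by exact_mod_cast hnLr
  -- the largest centred odd square inside the Fermi area
  obtain ⟨h, hm1, hm2⟩ := exists_odd_sq_le_lt hn1
  set m : ℕ := 2 * h + 1 with hm_def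
  have hm2' : n < (m + 2) ^ 2 := by
    rw [show m + 2 = 2 * h + 3 by omega]
    exact hm2
  have hmr1 : ((m : ℝ)) ^ 2 ≤ (n : ℝ) := by exact_mod_cast hm1
  have hmr2 : (n : ℝ) < ((m : ℝ) + 2) ^ 2 := by exact_mod_cast hm2'
  have hm_pos : (0 : ℝ) ≤ (m : ℝ) := by positivity
  have hπ := Real.pi_pos
  have hπ3 := Real.pi_lt_d6
  have e1 : ((2 * h + 1 : ℕ) : ℝ) = (m : ℝ) := by rw [hm_def]
  -- the surplus momenta: `n - m² ≤ 4m + 3 ≤ 4L + 3` once `m ≤ L`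
  have hsur_of : m ≤ L → ((n - (2 * h + 1) ^ 2 : ℕ) : ℝ) ≤ 4 * (L : ℝ) + 3 := by
    intro hmL
    have h1 : n - (2 * h + 1) ^ 2 ≤ 4 * L + 3 := by
      have h2 : n < (2 * h + 1) ^ 2 + 4 * (2 * h + 1) + 4 := by
        have e : (2 * h + 3) ^ 2 = (2 * h + 1) ^ 2 + 4 * (2 * h + 1) + 4 := by ring
        rw [← e]
        exact hm2
      have h3 : 2 * h + 1 ≤ L := by simpa [hm_def] using hmL
      omega
    exact_mod_cast h1
  -- the common estimate `c (s L - 3) L / 3.141593 ≤ m (L/π) sin(mπ/L)` from `c ≤ sin`, `s L - 3 ≤ m`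
  have hkey_of : ∀ c s : ℝ, 0 ≤ c → 0 ≤ s * (L : ℝ) - 3 → s * (L : ℝ) - 3 ≤ (m : ℝ) →
      c ≤ Real.sin ((2 * h + 1 : ℕ) * Real.pi / L) →
      c * (s * (L : ℝ) - 3) * ((L : ℝ) * (1 / 3.141593)) ≤
        ((2 * h + 1 : ℕ) : ℝ) * ((L : ℝ) / Real.pi * Real.sin ((2 * h + 1 : ℕ) * Real.pi / L)) := by
    intro c s hc hA0 hA hsin
    rw [e1]
    have hB : (L : ℝ) * (1 / 3.141593) ≤ (L : ℝ) / Real.pi := by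
      have hinv : (1 : ℝ) / 3.141593 ≤ 1 / Real.pi := one_div_le_one_div_of_le hπ hπ3.le
      calc (L : ℝ) * (1 / 3.141593) ≤ (L : ℝ) * (1 / Real.pi) := mul_le_mul_of_nonneg_left hinv hLpos.le
        _ = (L : ℝ) / Real.pi := by ring
    have hB0 : 0 ≤ (L : ℝ) * (1 / 3.141593) := by positivity
    calc c * (s * (L : ℝ) - 3) * ((L : ℝ) * (1 / 3.141593))
        = (s * (L : ℝ) - 3) * (((L : ℝ) * (1 / 3.141593)) * c) := by ring
      _ ≤ (m : ℝ) * (((L : ℝ) / Real.pi) * Real.sin ((2 * h + 1 : ℕ) * Real.pi / L)) := by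
          apply mul_le_mul hA _ (by positivity) hm_pos
          exact mul_le_mul hB hsin hc (by positivity)
      _ = (m : ℝ) * ((L : ℝ) / Real.pi * Real.sin ((2 * h + 1 : ℕ) * Real.pi / L)) := by ring
  have e_arg : ((2 * h + 1 : ℕ) : ℝ) * Real.pi / L = Real.pi * ((m : ℝ) / L) := by
    rw [hm_def]; field_simp
  rw [Nat.cast_sub hS]
  by_cases hpiece : δ ≤ 1 / 5
  · -- low-doping piece: band-edge bound
    have hn_ge' : 0.4 * (L : ℝ) ^ 2 - 1 ≤ (n : ℝ) := hlow_of hpiece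
    obtain ⟨hm_lo, hm_hi⟩ := square_side_bounds_low hLr hm_pos hmr1 hmr2 hn45 hn_ge'
    have hmL : m ≤ L := by
      have : (m : ℝ) ≤ L := by linarith
      exact_mod_cast this
    obtain ⟨T, hTcard, hTsum⟩ := exists_trialSet_card_eq hL3 h (by simpa [hm_def] using hmL) hm1 hnL
    have hl : T.toList.Nodup := Finset.nodup_toList T
    have hlen : T.toList.length = n := by rw [Finset.length_toList, hTcard]
    have hstoner := eight_spin_le_of_pairedSea hL3 hU0 hS hgs hspin hl hlen
    rw [Finset.toList_toFinset] at hstoner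
    have hsin : 0.855 ≤ Real.sin ((2 * h + 1 : ℕ) * Real.pi / L) := by
      rw [e_arg]
      apply sin_pi_mul_ge
      · rw [le_div_iff₀ hLpos]; linarith
      · rw [div_le_iff₀ hLpos]; linarith
    have hA0 : 0 ≤ 0.6324 * (L : ℝ) - 3 := by linarith
    have hkey := hkey_of 0.855 0.6324 (by norm_num) hA0 hm_lo.le hsin
    exact deficiency_arith_low hLr hU1 hn_ge' hstoner hTsum hkey (hsur_of hmL)
  · -- high-doping piece: shifted bound at `μ = 9/10`, `t = 31/10`
    push Not at hpiece
    have hn_le' : (n : ℝ) ≤ 0.4 * (L : ℝ) ^ 2 := hhigh_of hpiece.le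
    obtain ⟨hm_lo, hm_hi⟩ := square_side_bounds_high hLr hm_pos hmr1 hmr2 hn_le' hn35
    have hmL : m ≤ L := by
      have : (m : ℝ) ≤ L := by linarith
      exact_mod_cast this
    obtain ⟨T, hTcard, hTsum⟩ := exists_trialSet_card_eq hL3 h (by simpa [hm_def] using hmL) hm1 hnL
    have hl : T.toList.Nodup := Finset.nodup_toList T
    have hlen : T.toList.length = n := by rw [Finset.length_toList, hTcard]
    have hμt : (9 / 10 : ℝ) < 31 / 10 := by norm_num
    have hstoner := shifted_spin_le_of_pairedSea hL3 hU0 hS hgs hspin hl hlen hμt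
    rw [Finset.toList_toFinset] at hstoner
    have hsin : 0.913 ≤ Real.sin ((2 * h + 1 : ℕ) * Real.pi / L) := by
      rw [e_arg]
      apply sin_pi_mul_ge'
      · rw [le_div_iff₀ hLpos]; linarith
      · rw [div_le_iff₀ hLpos]; linarith
    have hA0 : 0 ≤ 0.5916 * (L : ℝ) - 3 := by linarith
    have hkey := hkey_of 0.913 0.5916 (by norm_num) hA0 hm_lo.le hsin
    exact deficiency_arith_high hLr hU1 hn35 hstoner hTsum hkey (hsur_of hmL)

/-- **The near-saturation refuter hypothesis fails for `U ≤ 6/5`.** For `(U, δ) ∈ [0, 6/5] × [1/10, 3/10]` it is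
NOT the case that for every `κ > 0` nearly saturated sector ground states (`n - S ≤ κL²`) occur along infinitely
many even sides: with `κ = 1/400`, any such side `L ≥ 4000` contradicts `spinDeficiency_ge_of_moderateCoupling`.
So `pointwise_false_of_nearlySaturated` and `fluctuationFloorAt_false_of_nearlySaturated` cannot fire on that part
of the box (supersedes the `U ≤ 1/2` statement `not_nearlySaturated_frequently_of_weakCoupling`). [folklore] -/
theorem not_nearlySaturated_frequently_of_moderateCoupling {U δ : ℝ} (hU : U ∈ Set.Icc (0:ℝ) (6 / 5))
    (hδ : δ ∈ Set.Icc (1 / 10 : ℝ) (3 / 10)) :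
    ¬ ∀ κ : ℝ, 0 < κ → ∃ᶠ L : ℕ in atTop, Even L ∧
      ∃ (ψ : Fock (Orb (FermionTorus 2 L))) (S : ℕ), S ≤ ⌊(1 - δ) * (L : ℝ) ^ 2 / 2⌋₊ ∧
        IsGroundStateInSector (hubbardTorus 2 L 1 U) (2 * ⌊(1 - δ) * (L : ℝ) ^ 2 / 2⌋₊) 0 ψ ∧
          spinSq *ᵥ ψ = (((S : ℝ) * ((S : ℝ) + 1) : ℝ) : ℂ) • ψ ∧
            ((⌊(1 - δ) * (L : ℝ) ^ 2 / 2⌋₊ - S : ℕ) : ℝ) ≤ κ * (L : ℝ) ^ 2 := by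
  intro hns
  obtain ⟨L, ⟨-, ψ, S, hS, hgs, hspin, hdef⟩, hLge⟩ :=
    ((hns (1 / 400) (by norm_num)).and_eventually (eventually_ge_atTop 4000)).exists
  haveI : NeZero L := ⟨by omega⟩
  have h := spinDeficiency_ge_of_moderateCoupling hU hδ hLge hgs hS hspin
  have hLpos : (0 : ℝ) < L := by exact_mod_cast (show 0 < L by omega)
  nlinarith [sq_nonneg (L : ℝ), mul_pos hLpos hLpos]

end Moderate

end Summit.HubbardSuperconductivity.HubbardSuperconductivity.Theorems.MesoscopicPairOrder.Negative
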